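import Mathlib
import Summits.ResolutionOfSingularities.ResolutionOfSingularities.Theorems.RadicialJungCleanModelsLens5TFramePort4Core
import HarnessLib

/-!
# Route `RadicialJung`, crux `CleanModels` (stmt-15917): T⁗ port part 6/13 — §G⁗.B the frame layer over a subring (`HasExp` calculus, adjugate units) (source :1773–2001; `HasExp` is in the currency)

PORT (line lead `res-B-lead-1` g8, for Sketch rev 32) of res-B-lens-5's crux workfiles `Cruxes/DescentPerfectToAll/Lens5_TFrame.lean` rev 4
(crux ae884a356928; author res-B-lens-5 g15; `lean check` rc 0 · 0 sorries · 0 warnings; crit-1 TRIAGE-146/150 PASS) and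
`Cruxes/DescentPerfectToAll/Lens5_PDegreeCount.lean` rev 3 (crux 100289d6413b; TRIAGE-151 PASS): THEOREMS T⁗ / T⁗′ / T⁗″ / T⁗‴ — the slice
{`[Γ:pΓ] = p²`, `k` of FINITE `p`-rank `r`, `[κ_v : κ_v^p] = p^r`} of the research stub `stub_cleanLU3DefectNonDiscrete` (valuations of MINIMAL
Frobenius defect `d(K|K^p, v) = p`, ANY such ground field: no perfectness, no separability of `K/k` or `κ_v/k`), modulo F-02 `CossartPiltant2019` and
F-32 (`hEmb`) only.  The port is split into def-free modules `…Lens5TFrame{RG,IR,Graded,Port2,Port4Core,Layer,Layer2,Port4,Composition,PMon,PDegreeA,PDegreeB,PDegreeC}`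
over ONE currency module `…Lens5TFrameCurrency` (the authors' `def`s, verbatim); declarations VERBATIM, namespace
`Summit.ResolutionOfSingularities.ResolutionOfSingularities.Theorems.RadicialJungCleanModels.Lens5TFrame` (the authors' §A copy of
`Lens5_PDegreeSep` and the constant-frame corollaries `cleanLU3DefectPRankTwoSepFin_of_frame` / `…SepFin_of_cossartPiltant2019'` are not ported).
OURS · counted 0 · nothing here proves resolution in characteristic `p`.


-/

set_option linter.dupNamespace false -- mandated namespace of this single-conjunct summit

section

open IsLocalRing
open Literature.AlgebraicGeometry.Resolution
open Summit.ResolutionOfSingularities.ResolutionOfSingularities.Theorems.RadicialJung.CleanModels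
open Summit.ResolutionOfSingularities.ResolutionOfSingularities.Theorems.RadicialJung.CleanModels.Lens5
open Summit.ResolutionOfSingularities.ResolutionOfSingularities.Theorems.RadicialJung.CleanModels.Lens5.PRankTwoCurrency
open Summit.ResolutionOfSingularities.ResolutionOfSingularities.Theorems.RadicialJung.CleanModels.Lens5.PRankTwoAssembly
open Summit.ResolutionOfSingularities.ResolutionOfSingularities.Theorems.RadicialJungCleanModels.Lens5RegularityCriterion
open Summit.ResolutionOfSingularities.ResolutionOfSingularities.Theorems.RadicialJungCleanModels.Lens5ChartSurjection

namespace Summit.ResolutionOfSingularities.ResolutionOfSingularities.Theorems.RadicialJungCleanModels.Lens5TFrame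

/-! ## §G⁗.B — the FRAME LAYER over a subring (memo §23 (F1), (F3)–(F5))
`HasExp S₀ W a`: `a = Σ_s e_s W_s` with coefficients `e_s ∈ S₀`.  Generic closure lemmas; then, for `S₀ = locAtCentre A₀ O` and a frame
`W` with RG over `S₀` («each term is bounded by the sum»), the unit/adjugate argument (F1), uniqueness, the description of the maximal
ideal (F3), integrality and equality of dimensions, regularity transfer (F4) and the transfer of a regular parameter (F5). -/

section FrameLayer

variable {K : Type} [Field K]


variable {ι : Type} [Fintype ι]

/-- `0` has the zero expansion. [folklore] -/
theorem hasExp_zero (S₀ : Subring K) (W : ι → K) : HasExp S₀ W 0 :=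
  ⟨fun _ => 0, fun _ => S₀.zero_mem, by simp⟩

/-- Expansions add. [folklore] -/
theorem hasExp_add {S₀ : Subring K} {W : ι → K} {a b : K} (ha : HasExp S₀ W a) (hb : HasExp S₀ W b) :
    HasExp S₀ W (a + b) := by
  obtain ⟨e, he, rfl⟩ := ha
  obtain ⟨f, hf, rfl⟩ := hb
  refine ⟨fun s => e s + f s, fun s => S₀.add_mem (he s) (hf s), ?_⟩
  rw [← Finset.sum_add_distrib]
  exact Finset.sum_congr rfl fun s _ => by ring

/-- Expansions are stable under multiplication by elements of `S₀`. [folklore] -/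
theorem hasExp_mul_left {S₀ : Subring K} {W : ι → K} {a c : K} (hc : c ∈ S₀) (ha : HasExp S₀ W a) :
    HasExp S₀ W (c * a) := by
  obtain ⟨e, he, rfl⟩ := ha
  refine ⟨fun s => c * e s, fun s => S₀.mul_mem hc (he s), ?_⟩
  rw [Finset.mul_sum]
  exact Finset.sum_congr rfl fun s _ => by ring

/-- Finite sums of elements with expansions have expansions. [folklore] -/
theorem hasExp_sum {S₀ : Subring K} {W : ι → K} {α : Type} (T : Finset α) (f : α → K)
    (h : ∀ i ∈ T, HasExp S₀ W (f i)) : HasExp S₀ W (∑ i ∈ T, f i) := by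
  classical
  induction T using Finset.induction_on with
  | empty => rw [Finset.sum_empty]; exact hasExp_zero S₀ W
  | insert a T haT ih =>
    rw [Finset.sum_insert haT]
    exact hasExp_add (h a (Finset.mem_insert_self a T)) (ih fun i hi => h i (Finset.mem_insert_of_mem hi))

/-- `c · W_s` has an expansion for `c ∈ S₀`. [folklore] -/
theorem hasExp_single {S₀ : Subring K} {W : ι → K} {c : K} (hc : c ∈ S₀) (s : ι) : HasExp S₀ W (c * W s) := by
  classical
  refine ⟨fun s' => if s' = s then c else 0, fun s' => ?_, ?_⟩
  · show (if s' = s then c else 0) ∈ S₀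
    split_ifs
    exacts [hc, S₀.zero_mem]
  · show c * W s = ∑ s', (if s' = s then c else 0) * W s'
    simp_rw [ite_mul, zero_mul, Finset.sum_ite_eq', Finset.mem_univ, if_true]

/-- For a multiplicative frame (`W_s W_t` expandable) expansions multiply. [folklore] -/
theorem hasExp_mul {S₀ : Subring K} {W : ι → K} (hWW : ∀ s t, HasExp S₀ W (W s * W t)) {a b : K}
    (ha : HasExp S₀ W a) (hb : HasExp S₀ W b) : HasExp S₀ W (a * b) := by
  obtain ⟨e, he, rfl⟩ := ha
  obtain ⟨f, hf, rfl⟩ := hb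
  rw [Finset.sum_mul_sum]
  refine hasExp_sum _ _ fun s _ => hasExp_sum _ _ fun t _ => ?_
  have : e s * W s * (f t * W t) = (e s * f t) * (W s * W t) := by ring
  rw [this]
  exact hasExp_mul_left (S₀.mul_mem (he s) (hf t)) (hWW s t)

variable (O : ValuationSubring K)

/-- Coefficients are unique (indeed zero sum ⇒ zero coefficients) under RG. -/
theorem hasExp_unique {S₀ : Subring K} {W : ι → K} (hWv : ∀ s, O.valuation (W s) = 1)
    (RG₀ : ∀ e : ι → K, (∀ s, e s ∈ S₀) → ∀ s₀, O.valuation (e s₀ * W s₀) ≤ O.valuation (∑ s, e s * W s))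
    {e : ι → K} (he : ∀ s, e s ∈ S₀) (h0 : ∑ s, e s * W s = 0) : ∀ s, e s = 0 := by
  intro s
  have h := RG₀ e he s
  rw [h0, map_zero, le_zero_iff, map_mul, hWv, mul_one, map_eq_zero] at h
  exact h

/-- (F3) Under RG, `Σ e_s W_s` has value `< 1` iff every coefficient has. -/
theorem valuation_exp_lt_one_iff {S₀ : Subring K} {W : ι → K}
    (hWv : ∀ s, O.valuation (W s) = 1)
    (RG₀ : ∀ e : ι → K, (∀ s, e s ∈ S₀) → ∀ s₀, O.valuation (e s₀ * W s₀) ≤ O.valuation (∑ s, e s * W s))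
    {e : ι → K} (he : ∀ s, e s ∈ S₀) : O.valuation (∑ s, e s * W s) < 1 ↔ ∀ s, O.valuation (e s) < 1 := by
  constructor
  · intro h s
    have := RG₀ e he s
    rw [map_mul, hWv, mul_one] at this
    exact lt_of_le_of_lt this h
  · intro h
    exact O.valuation.map_sum_lt one_ne_zero fun s _ => by rw [map_mul, hWv, mul_one]; exact h s

/-- (F1, units) If `c` of value `1` multiplies the frame into expansions and `1` has an expansion, then `c⁻¹` has an expansion:
the determinant of the multiplication matrix is a unit of the local ring `S₀ = locAtCentre A₀ O` (RG ⇒ the matrix is injective modulo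
`𝔪_{S₀}`), and the adjugate inverts it. -/
theorem hasExp_inv {k : Type} [Field k] [Algebra k K] {A₀ : Subalgebra k K} (hA₀O : A₀.toSubring ≤ O.toSubring)
    {W : ι → K} (hWv : ∀ s, O.valuation (W s) = 1)
    (RG₀ : ∀ e : ι → K, (∀ s, e s ∈ locAtCentre A₀.toSubring O) →
      ∀ s₀, O.valuation (e s₀ * W s₀) ≤ O.valuation (∑ s, e s * W s))
    (h1 : HasExp (locAtCentre A₀.toSubring O) W 1) {c : K} (hvc : O.valuation c = 1)
    (hcN : ∀ t, HasExp (locAtCentre A₀.toSubring O) W (c * W t)) :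
    HasExp (locAtCentre A₀.toSubring O) W c⁻¹ := by
  classical
  set S₀ : Subring K := locAtCentre A₀.toSubring O with hS₀def
  haveI : IsLocalRing S₀ := isLocalRing_locAtCentre hA₀O
  have hS₀O : S₀ ≤ O.toSubring := locAtCentre_le hA₀O
  have coe_sum : ∀ f : ι → S₀, (((∑ t, f t : S₀)) : K) = ∑ t, (f t : K) := fun f => map_sum S₀.subtype f Finset.univ
  choose Mx hMxS hMx using hcN
  set MxS : Matrix ι ι S₀ := Matrix.of fun s t => (⟨Mx t s, hMxS t s⟩ : S₀) with hMxSdef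
  have hMxSval : ∀ s t, ((MxS s t : S₀) : K) = Mx t s := fun s t => rfl
  -- the multiplication identity: `c * Σ_t e_t W_t = Σ_s (MxS e)_s W_s`
  have hcmul : ∀ e : ι → S₀, c * ∑ t, (e t : K) * W t = ∑ s, ((MxS.mulVec e) s : K) * W s := by
    intro e
    have hR : ∀ s, ((MxS.mulVec e) s : K) = ∑ t, Mx t s * (e t : K) := by
      intro s
      change ((∑ t, MxS s t * e t : S₀) : K) = _
      rw [coe_sum]
      rfl
    simp_rw [hR]
    calc c * ∑ t, (e t : K) * W t = ∑ t, (e t : K) * (c * W t) := by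
          rw [Finset.mul_sum]; exact Finset.sum_congr rfl fun t _ => by ring
      _ = ∑ t, (e t : K) * ∑ s, Mx t s * W s := Finset.sum_congr rfl fun t _ => by rw [hMx t]
      _ = ∑ t, ∑ s, Mx t s * (e t : K) * W s := by
          refine Finset.sum_congr rfl fun t _ => ?_
          rw [Finset.mul_sum]; exact Finset.sum_congr rfl fun s _ => by ring
      _ = ∑ s, ∑ t, Mx t s * (e t : K) * W s := Finset.sum_comm
      _ = ∑ s, (∑ t, Mx t s * (e t : K)) * W s := Finset.sum_congr rfl fun s _ => by rw [Finset.sum_mul]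
  -- RG ⇒ the matrix is injective modulo `𝔪_{S₀}`
  have hker : ∀ e : ι → S₀, (∀ s, (MxS.mulVec e) s ∈ IsLocalRing.maximalIdeal S₀) →
      ∀ t, e t ∈ IsLocalRing.maximalIdeal S₀ := by
    intro e he t
    have hlt : O.valuation (∑ s, ((MxS.mulVec e) s : K) * W s) < 1 :=
      O.valuation.map_sum_lt one_ne_zero fun s _ => by
        rw [map_mul, hWv, mul_one]; exact (mem_maximalIdeal_locAtCentre_iff hA₀O _).mp (he s)
    rw [← hcmul, map_mul, hvc, one_mul] at hlt
    have h := RG₀ (fun t => (e t : K)) (fun t => (e t).2) t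
    rw [map_mul, hWv, mul_one] at h
    exact (mem_maximalIdeal_locAtCentre_iff hA₀O _).mpr (lt_of_le_of_lt h hlt)
  have hdet : IsUnit MxS.det := by
    by_contra hnu
    have hm : MxS.det ∈ IsLocalRing.maximalIdeal S₀ := by
      rw [IsLocalRing.mem_maximalIdeal, mem_nonunits_iff]; exact hnu
    have h0 : (MxS.map (IsLocalRing.residue S₀)).det = 0 := by
      rw [← RingHom.mapMatrix_apply, ← RingHom.map_det]
      exact (IsLocalRing.residue_eq_zero_iff _).mpr hm
    obtain ⟨vb, hvb0, hvb⟩ := Matrix.exists_mulVec_eq_zero_iff.mpr h0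
    choose e he using fun t => Ideal.Quotient.mk_surjective (I := IsLocalRing.maximalIdeal S₀) (vb t)
    have hme : ∀ s, (MxS.mulVec e) s ∈ IsLocalRing.maximalIdeal S₀ := by
      intro s
      rw [← IsLocalRing.residue_eq_zero_iff]
      have hs := congr_fun hvb s
      rw [Pi.zero_apply] at hs
      rw [← hs]
      simp only [Matrix.mulVec, dotProduct, map_sum, map_mul, Matrix.map_apply]
      exact Finset.sum_congr rfl fun t _ => by rw [← he t]; rfl
    have hall := hker e hme
    apply hvb0
    funext t
    rw [← he t, Pi.zero_apply]
    exact Ideal.Quotient.eq_zero_iff_mem.mpr (hall t)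
  have hv1 : O.valuation ((MxS.det : S₀) : K) = 1 := by
    have hnlt : ¬ O.valuation ((MxS.det : S₀) : K) < 1 := fun h =>
      ((not_isUnit_locAtCentre_iff hA₀O _).mpr h) hdet
    exact le_antisymm ((O.valuation_le_one_iff _).mpr (hS₀O (MxS.det).2)) (not_lt.mp hnlt)
  have hδ0 : ((MxS.det : S₀) : K) ≠ 0 := ne_zero_of_valuation_eq_one hv1
  have hδinv : ((MxS.det : S₀) : K)⁻¹ ∈ S₀ := inv_mem_locAtCentre (MxS.det).2 hv1
  -- the adjugate identity: `det · W_r = c · Σ_t adj_{t r} W_t`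
  have hent : ∀ s r, ∑ t, MxS s t * MxS.adjugate t r = if s = r then MxS.det else 0 := by
    intro s r
    have := congr_fun (congr_fun (Matrix.mul_adjugate MxS) s) r
    rw [Matrix.mul_apply, Matrix.smul_apply, Matrix.one_apply, smul_eq_mul, mul_ite, mul_one, mul_zero] at this
    exact this
  have hadj : ∀ r, ((MxS.det : S₀) : K) * W r = c * ∑ t, ((MxS.adjugate t r : S₀) : K) * W t := by
    intro r
    symm
    calc c * ∑ t, ((MxS.adjugate t r : S₀) : K) * W t
        = ∑ t, ((MxS.adjugate t r : S₀) : K) * (c * W t) := by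
          rw [Finset.mul_sum]; exact Finset.sum_congr rfl fun t _ => by ring
      _ = ∑ t, ((MxS.adjugate t r : S₀) : K) * ∑ s, Mx t s * W s :=
          Finset.sum_congr rfl fun t _ => by rw [hMx t]
      _ = ∑ t, ∑ s, ((MxS s t : S₀) : K) * ((MxS.adjugate t r : S₀) : K) * W s := by
          refine Finset.sum_congr rfl fun t _ => ?_
          rw [Finset.mul_sum]
          exact Finset.sum_congr rfl fun s _ => by rw [hMxSval]; ring
      _ = ∑ s, ∑ t, ((MxS s t : S₀) : K) * ((MxS.adjugate t r : S₀) : K) * W s := Finset.sum_comm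
      _ = ∑ s, ((∑ t, MxS s t * MxS.adjugate t r : S₀) : K) * W s := by
          refine Finset.sum_congr rfl fun s _ => ?_
          rw [← Finset.sum_mul, coe_sum]
          rfl
      _ = ∑ s, (if s = r then ((MxS.det : S₀) : K) else 0) * W s := by
          refine Finset.sum_congr rfl fun s _ => ?_
          rw [hent s r]
          split_ifs <;> rfl
      _ = ((MxS.det : S₀) : K) * W r := by
          rw [Finset.sum_eq_single r (fun s _ hs => by rw [if_neg hs, zero_mul])
            (fun h => absurd (Finset.mem_univ r) h), if_pos rfl]
  -- the expansion of `c⁻¹`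
  obtain ⟨ε, hεS, hε1⟩ := h1
  have hc0 : c ≠ 0 := ne_zero_of_valuation_eq_one hvc
  have key : (1 : K) = c * ∑ t, (∑ r, ((MxS.det : S₀) : K)⁻¹ * ε r * ((MxS.adjugate t r : S₀) : K)) * W t := by
    calc (1 : K) = ∑ r, ε r * W r := hε1
      _ = ∑ r, ε r * (((MxS.det : S₀) : K)⁻¹ * (c * ∑ t, ((MxS.adjugate t r : S₀) : K) * W t)) :=
          Finset.sum_congr rfl fun r _ => by rw [← hadj r, ← mul_assoc _ _ (W r), inv_mul_cancel₀ hδ0, one_mul]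
      _ = ∑ r, ∑ t, c * ((((MxS.det : S₀) : K)⁻¹ * ε r * ((MxS.adjugate t r : S₀) : K)) * W t) := by
          refine Finset.sum_congr rfl fun r _ => ?_
          rw [Finset.mul_sum, Finset.mul_sum, Finset.mul_sum]
          exact Finset.sum_congr rfl fun t _ => by ring
      _ = ∑ t, ∑ r, c * ((((MxS.det : S₀) : K)⁻¹ * ε r * ((MxS.adjugate t r : S₀) : K)) * W t) := Finset.sum_comm
      _ = c * ∑ t, (∑ r, ((MxS.det : S₀) : K)⁻¹ * ε r * ((MxS.adjugate t r : S₀) : K)) * W t := by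
          rw [Finset.mul_sum]
          refine Finset.sum_congr rfl fun t _ => ?_
          rw [Finset.sum_mul, Finset.mul_sum]
  refine ⟨fun t => ∑ r, ((MxS.det : S₀) : K)⁻¹ * ε r * ((MxS.adjugate t r : S₀) : K), fun t =>
    sum_mem fun r _ => S₀.mul_mem (S₀.mul_mem hδinv (hεS r)) (MxS.adjugate t r).2, ?_⟩
  calc c⁻¹ = c⁻¹ * 1 := (mul_one _).symm
    _ = c⁻¹ * (c * ∑ t, (∑ r, ((MxS.det : S₀) : K)⁻¹ * ε r * ((MxS.adjugate t r : S₀) : K)) * W t) := by rw [← key]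
    _ = ∑ t, (∑ r, ((MxS.det : S₀) : K)⁻¹ * ε r * ((MxS.adjugate t r : S₀) : K)) * W t := by
        rw [← mul_assoc, inv_mul_cancel₀ hc0, one_mul]

/-- (F1) `S := locAtCentre A'' O = Σ_s W_s S₀` when `A''` is spanned by the frame over `S₀ := locAtCentre A₀ O` with RG. -/
theorem hasExp_of_mem_locAtCentre {k : Type} [Field k] [Algebra k K] {A₀ A'' : Subalgebra k K}
    (hA''O : A''.toSubring ≤ O.toSubring) (h0le : A₀ ≤ A'')
    {W : ι → K} (hWA'' : ∀ s, W s ∈ A'') (hWv : ∀ s, O.valuation (W s) = 1)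
    (RG₀ : ∀ e : ι → K, (∀ s, e s ∈ locAtCentre A₀.toSubring O) →
      ∀ s₀, O.valuation (e s₀ * W s₀) ≤ O.valuation (∑ s, e s * W s))
    (hgenN : ∀ a ∈ A'', HasExp (locAtCentre A₀.toSubring O) W a)
    {a : K} (ha : a ∈ locAtCentre A''.toSubring O) : HasExp (locAtCentre A₀.toSubring O) W a := by
  have hA₀O : A₀.toSubring ≤ O.toSubring := fun x hx => hA''O (h0le hx)
  obtain ⟨y, hy, c, hc, hvc, rfl⟩ := mem_locAtCentre_iff.mp ha
  rw [div_eq_mul_inv]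
  have hWW : ∀ s t, HasExp (locAtCentre A₀.toSubring O) W (W s * W t) := fun s t =>
    hgenN _ (A''.mul_mem (hWA'' s) (hWA'' t))
  exact hasExp_mul hWW (hgenN y hy)
    (hasExp_inv O hA₀O hWv RG₀ (hgenN 1 A''.one_mem) hvc fun t => hgenN _ (A''.mul_mem hc (hWA'' t)))

end FrameLayer

end Summit.ResolutionOfSingularities.ResolutionOfSingularities.Theorems.RadicialJungCleanModels.Lens5TFrame

end
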